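/-
Origin: expansion seat `planner-pub-hodgecm-pv07-0`, handover 2026-08-18T03:35:56Z (`HOME/pub-hodgecm-pv07/lean/Pv07/BallDichotomy.lean`, md5 ae91119d, 232 lines);
landed by the gen-5 packager in gate run 19 as `HodgeCM/PerL34/LocalFactors/BallDichotomy.lean` (verbatim).
-/
/-
Copyright: pub-hodgecm formalisation cell (harness21, 2026). New file (not vendored).
Origin: pub-hodgecm-pv07 (DAG-NODE PROVER #07), node N31f = PerL v5 Lemma 4.2(b), proof step
"LOCAL FACTORS" (tex ll. 608–623).  This file: the SPLIT-PLACE BALL LEMMA (tex ll. 617–623).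
Intended final place: `HodgeCM/PerL34/LocalFactors/BallDichotomy.lean` (packager's choice).
-/
import Mathlib

/-!
# N31f (i) — the split-place ball lemma of PerL v5, Lemma 4.2(b) (tex ll. 617–623)

Verbatim (tex ll. 617–623): "at split `v` take `φ_v` the characteristic function of a ball
`D = x₀ + ϖ^N 𝒪³` around a point `x₀ ≠ 0`, with `N > ord(x₀) := min_j ord(x_{0,j})` (minimum over
the coordinates) so large that the open subgroup `U₁ := {y ∈ L_{0,v}^× : (y−1)x₀ ∈ ϖ^N 𝒪³} ⊂ 𝒪^×`
lies in the kernels of `χ'_v` and of the auxiliary unitary character of the Weil representation;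
for `y ∈ U₁` one has `yD = D`, while for `y ∉ U₁`, `yD ∩ D = ∅` (compare absolute values if
`|y| ≠ 1`, first digits otherwise); hence `m = vol(D)𝟙_{U₁}` and `I_v(φ_v) = vol(D)vol(U₁) > 0`."

TYPING (pv07's, verbatim up to the following dictionary; the carver's `LocalFactors.lean` stub
was not yet published when this file was written).  Over ANY field `F` with a nonarchimedean
(ultrametric) absolute value and any finite index type `ι` (PerL: `F = L_{0,v}`, `ι = Fin 3`), with
the sup norm on `ι → F`:
* `ϖ^N 𝒪³` is the closed ball of radius `r = |ϖ|^N > 0` about `0`, so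
  `D = x₀ + ϖ^N 𝒪³ = Metric.closedBall x₀ r`;
* `N > ord(x₀) = min_j ord(x₀ⱼ)` ⟺ `r < ‖x₀‖ = max_j |x₀ⱼ|` (this also encodes `x₀ ≠ 0`);
* `U₁ = {y : (y − 1)x₀ ∈ ϖ^N 𝒪³} = {y : ‖(y − 1) • x₀‖ ≤ r}` (`U1 x₀ r` below).

PROVED here (kernel; hypotheses only `r < ‖x₀‖`, and `0 < r` for openness):
* `U₁ ⊂ 𝒪^×`: `norm_eq_one_of_mem_U1`; `U₁` is a subgroup: `one_mem_U1`, `mul_mem_U1`,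
  `inv_mem_U1`; `U₁` is open: `isOpen_U1` (it is the closed ball `closedBall 1 (r/‖x₀‖)`,
  `U1_eq_closedBall`);
* "for `y ∈ U₁` one has `yD = D`": `smul_ball_eq_of_mem_U1`;
* "for `y ∉ U₁`, `yD ∩ D = ∅`": `disjoint_smul_ball_of_not_mem_U1` (via
  `mem_U1_of_smul_mem_ball`: compare absolute values, then first digits — exactly the tex's
  two-case argument, merged);
* the set identity behind "`m = vol(D)𝟙_{U₁}`": `{x ∈ D : yx ∈ D} = D` for `y ∈ U₁`, `= ∅` for
  `y ∉ U₁` (`ball_inter_preimage_smul_of_mem_U1`, `ball_inter_preimage_smul_of_not_mem_U1`).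
The measure-theoretic consequences (`m = vol(D)𝟙_{U₁}`, `I_v = vol(D)vol(U₁) > 0`) are in
`Pv07.SplitFactor` (final place `HodgeCM/PerL34/LocalFactors/SplitFactor.lean`).
-/

set_option autoImplicit false

namespace HodgeCM
namespace PerL34
namespace LocalFactors

open Metric Set
open scoped Pointwise

variable {F : Type*} [NormedField F] [IsUltrametricDist F]
variable {ι : Type*} [Fintype ι]

/-- PerL's `U₁ := {y : (y − 1)x₀ ∈ ϖ^N 𝒪³}` (tex l. 620), with `ϖ^N 𝒪³ = closedBall 0 r`. -/
def U1 (x₀ : ι → F) (r : ℝ) : Set F := {y : F | ‖(y - 1) • x₀‖ ≤ r}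

omit [IsUltrametricDist F] in
/-- (Ported verbatim from the HodgeCMPerL package; no docstring in the source.) -/
theorem mem_U1 {x₀ : ι → F} {r : ℝ} {y : F} : y ∈ U1 x₀ r ↔ ‖(y - 1) • x₀‖ ≤ r := Iff.rfl

/-- "first digits": a point `d` of `D = x₀ + ϖ^N 𝒪³` with `N > ord(x₀)` has `|d| = |x₀|`. -/
theorem norm_eq_of_mem_ball {x₀ d : ι → F} {r : ℝ} (hr : r < ‖x₀‖)
    (hd : d ∈ closedBall x₀ r) : ‖d‖ = ‖x₀‖ := by
  rw [mem_closedBall, dist_eq_norm] at hd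
  have hne : ‖x₀‖ ≠ ‖d - x₀‖ := by
    intro h
    rw [← h] at hd
    exact absurd hd (not_le.mpr hr)
  have key := IsUltrametricDist.norm_add_eq_max_of_norm_ne_norm hne
  have hsum : x₀ + (d - x₀) = d := by abel
  rw [hsum] at key
  rw [key, max_eq_left]
  exact le_of_lt (lt_of_le_of_lt hd hr)

/-- `U₁ ⊂ 𝒪^×` (tex l. 620): `y ∈ U₁ → |y| = 1`. -/
theorem norm_eq_one_of_mem_U1 {x₀ : ι → F} {r : ℝ} (hr : r < ‖x₀‖) {y : F}
    (hy : y ∈ U1 x₀ r) : ‖y‖ = 1 := by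
  rw [mem_U1, norm_smul] at hy
  have hx : 0 < ‖x₀‖ := lt_of_le_of_lt (le_trans (by positivity) hy) hr
  have h1 : ‖y - 1‖ < 1 := by
    refine lt_of_not_ge fun h => ?_
    have : ‖x₀‖ ≤ ‖y - 1‖ * ‖x₀‖ := le_mul_of_one_le_left (norm_nonneg _) h
    exact absurd (lt_of_le_of_lt (le_trans this hy) hr) (lt_irrefl _)
  have hne : ‖(1 : F)‖ ≠ ‖y - 1‖ := by
    rw [norm_one]
    exact ne_of_gt h1
  have key := IsUltrametricDist.norm_add_eq_max_of_norm_ne_norm hne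
  have hsum : (1 : F) + (y - 1) = y := by abel
  rw [hsum, norm_one, max_eq_left h1.le] at key
  exact key

/-- (Ported verbatim from the HodgeCMPerL package; no docstring in the source.) -/
theorem ne_zero_of_mem_U1 {x₀ : ι → F} {r : ℝ} (hr : r < ‖x₀‖) {y : F}
    (hy : y ∈ U1 x₀ r) : y ≠ 0 := by
  intro h
  have := norm_eq_one_of_mem_U1 hr hy
  rw [h, norm_zero] at this
  exact zero_ne_one this

omit [IsUltrametricDist F] in
/-- `U₁` is a subgroup: `1 ∈ U₁`. -/
theorem one_mem_U1 {x₀ : ι → F} {r : ℝ} (hr0 : 0 ≤ r) : (1 : F) ∈ U1 x₀ r := by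
  rw [mem_U1, sub_self, zero_smul, norm_zero]
  exact hr0

/-- `U₁` is a subgroup: closed under multiplication. -/
theorem mul_mem_U1 {x₀ : ι → F} {r : ℝ} (hr : r < ‖x₀‖) {y z : F} (hy : y ∈ U1 x₀ r)
    (hz : z ∈ U1 x₀ r) : y * z ∈ U1 x₀ r := by
  have hy1 := norm_eq_one_of_mem_U1 hr hy
  rw [mem_U1] at hy hz ⊢
  have hdec : (y * z - 1) • x₀ = y • ((z - 1) • x₀) + (y - 1) • x₀ := by
    rw [smul_smul, ← add_smul]
    congr 1
    ring
  rw [hdec]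
  calc ‖y • ((z - 1) • x₀) + (y - 1) • x₀‖
      ≤ max ‖y • ((z - 1) • x₀)‖ ‖(y - 1) • x₀‖ := IsUltrametricDist.norm_add_le_max _ _
    _ ≤ r := by
        rw [norm_smul, hy1, one_mul]
        exact max_le hz hy

/-- `U₁` is a subgroup: closed under inversion. -/
theorem inv_mem_U1 {x₀ : ι → F} {r : ℝ} (hr : r < ‖x₀‖) {y : F} (hy : y ∈ U1 x₀ r) :
    y⁻¹ ∈ U1 x₀ r := by
  have hy1 := norm_eq_one_of_mem_U1 hr hy
  have hy0 := ne_zero_of_mem_U1 hr hy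
  rw [mem_U1] at hy ⊢
  have halg : y⁻¹ - 1 = -y⁻¹ * (y - 1) := by
    rw [neg_mul, mul_sub, inv_mul_cancel₀ hy0, mul_one, neg_sub]
  rw [halg, ← smul_smul, norm_smul, norm_neg, norm_inv, hy1, inv_one, one_mul]
  exact hy

omit [IsUltrametricDist F] in
/-- `U₁` as a closed ball about `1` (for `x₀ ≠ 0`). -/
theorem U1_eq_closedBall {x₀ : ι → F} (hx : x₀ ≠ 0) (r : ℝ) :
    U1 x₀ r = closedBall (1 : F) (r / ‖x₀‖) := by
  have hx' : 0 < ‖x₀‖ := norm_pos_iff.mpr hx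
  ext y
  rw [mem_U1, mem_closedBall, dist_eq_norm, norm_smul, le_div_iff₀ hx']

/-- tex ll. 619–620: `U₁` is OPEN (an "open subgroup"); here for any radius `r > 0`. -/
theorem isOpen_U1 {x₀ : ι → F} {r : ℝ} (hr0 : 0 < r) : IsOpen (U1 x₀ r) := by
  by_cases hx : x₀ = 0
  · have hall : U1 x₀ r = univ := by
      ext y
      simp only [mem_U1, hx, smul_zero, norm_zero, mem_univ, iff_true]
      exact hr0.le
    rw [hall]
    exact isOpen_univ
  · rw [U1_eq_closedBall hx]
    exact IsUltrametricDist.isOpen_closedBall _ (div_pos hr0 (norm_pos_iff.mpr hx)).ne'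

/-- tex l. 621, first half: `y ∈ U₁ → yD ⊆ D`. -/
theorem smul_ball_subset_of_mem_U1 {x₀ : ι → F} {r : ℝ} (hr : r < ‖x₀‖) {y : F}
    (hy : y ∈ U1 x₀ r) : y • closedBall x₀ r ⊆ closedBall x₀ r := by
  have hy1 := norm_eq_one_of_mem_U1 hr hy
  rw [mem_U1] at hy
  intro z hz
  obtain ⟨d, hd, rfl⟩ := mem_smul_set.mp hz
  rw [mem_closedBall, dist_eq_norm] at hd ⊢
  have hdec : y • d - x₀ = y • (d - x₀) + (y - 1) • x₀ := by
    rw [smul_sub, sub_smul, one_smul]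
    abel
  rw [hdec]
  calc ‖y • (d - x₀) + (y - 1) • x₀‖
      ≤ max ‖y • (d - x₀)‖ ‖(y - 1) • x₀‖ := IsUltrametricDist.norm_add_le_max _ _
    _ ≤ r := by
        rw [norm_smul, hy1, one_mul]
        exact max_le hd hy

/-- tex l. 621: "for `y ∈ U₁` one has `yD = D`". -/
theorem smul_ball_eq_of_mem_U1 {x₀ : ι → F} {r : ℝ} (hr : r < ‖x₀‖) {y : F}
    (hy : y ∈ U1 x₀ r) : y • closedBall x₀ r = closedBall x₀ r := by
  refine (smul_ball_subset_of_mem_U1 hr hy).antisymm ?_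
  intro d hd
  have hy0 := ne_zero_of_mem_U1 hr hy
  refine mem_smul_set.mpr ⟨y⁻¹ • d, ?_, by rw [smul_smul, mul_inv_cancel₀ hy0, one_smul]⟩
  exact smul_ball_subset_of_mem_U1 hr (inv_mem_U1 hr hy) (smul_mem_smul_set hd)

/-- tex l. 621–622, the two-case argument: if `d ∈ D` and `yd ∈ D` then `y ∈ U₁` ("compare
absolute values if `|y| ≠ 1`" gives `|y| = 1`; "first digits otherwise" gives
`(y − 1)x₀ ∈ ϖ^N 𝒪³`). -/
theorem mem_U1_of_smul_mem_ball {x₀ : ι → F} {r : ℝ} (hr : r < ‖x₀‖) {y : F} {d : ι → F}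
    (hd : d ∈ closedBall x₀ r) (hyd : y • d ∈ closedBall x₀ r) : y ∈ U1 x₀ r := by
  -- compare absolute values: `|y| = 1`
  have h1 : ‖d‖ = ‖x₀‖ := norm_eq_of_mem_ball hr hd
  have h2 : ‖y • d‖ = ‖x₀‖ := norm_eq_of_mem_ball hr hyd
  rw [mem_closedBall, dist_eq_norm] at hd hyd
  have hx : 0 < ‖x₀‖ := lt_of_le_of_lt (le_trans (norm_nonneg _) hd) hr
  rw [norm_smul, h1] at h2
  have hy1 : ‖y‖ = 1 := by
    have h3 : ‖y‖ * ‖x₀‖ = 1 * ‖x₀‖ := by rw [h2, one_mul]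
    exact mul_right_cancel₀ hx.ne' h3
  -- first digits: `(y − 1)x₀ = (yd − x₀) − y(d − x₀) ∈ ϖ^N 𝒪³`
  rw [mem_U1]
  have hdec : (y - 1) • x₀ = (y • d - x₀) + -(y • (d - x₀)) := by
    rw [sub_smul, one_smul, smul_sub]
    abel
  rw [hdec]
  calc ‖(y • d - x₀) + -(y • (d - x₀))‖
      ≤ max ‖y • d - x₀‖ ‖-(y • (d - x₀))‖ := IsUltrametricDist.norm_add_le_max _ _
    _ ≤ r := by
        rw [norm_neg, norm_smul, hy1, one_mul]
        exact max_le hyd hd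

/-- tex l. 621: "for `y ∉ U₁`, `yD ∩ D = ∅`". -/
theorem disjoint_smul_ball_of_not_mem_U1 {x₀ : ι → F} {r : ℝ} (hr : r < ‖x₀‖) {y : F}
    (hy : y ∉ U1 x₀ r) : Disjoint (y • closedBall x₀ r) (closedBall x₀ r) := by
  rw [Set.disjoint_left]
  intro z hz hz'
  obtain ⟨d, hd, rfl⟩ := mem_smul_set.mp hz
  exact hy (mem_U1_of_smul_mem_ball hr hd hz')

/-- The set `{x ∈ D : yx ∈ D}` whose volume is `⟨ω(y)𝟙_D, 𝟙_D⟩` up to the factor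
`ν(y)|y|^{3/2}` (tex l. 611): it is all of `D` for `y ∈ U₁` … -/
theorem ball_inter_preimage_smul_of_mem_U1 {x₀ : ι → F} {r : ℝ} (hr : r < ‖x₀‖) {y : F}
    (hy : y ∈ U1 x₀ r) :
    closedBall x₀ r ∩ (fun x => y • x) ⁻¹' closedBall x₀ r = closedBall x₀ r := by
  apply inter_eq_left.mpr
  intro d hd
  exact smul_ball_subset_of_mem_U1 hr hy (smul_mem_smul_set hd)

/-- … and empty for `y ∉ U₁` (tex l. 621–622: "hence `m = vol(D)𝟙_{U₁}`"). -/
theorem ball_inter_preimage_smul_of_not_mem_U1 {x₀ : ι → F} {r : ℝ} (hr : r < ‖x₀‖) {y : F}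
    (hy : y ∉ U1 x₀ r) :
    closedBall x₀ r ∩ (fun x => y • x) ⁻¹' closedBall x₀ r = ∅ := by
  ext d
  simp only [mem_inter_iff, mem_preimage, mem_empty_iff_false, iff_false, not_and]
  intro hd hyd
  exact hy (mem_U1_of_smul_mem_ball hr hd hyd)

end LocalFactors
end PerL34
end HodgeCM
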